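import Summits.CriticalPhenomena.PercolationContinuityZ3.Theorems.PercNearOneGluingNoHeavyLowerTailSahiThreeCopyPolarization

/-!
# `NoHeavyLowerTail` (crux stmt-CriticalPhenomena-4575), Sahi programme: **SETTLED CASES OF THE POLARIZED CHAIN LAW**

Support file (Sahi cell, seat `prim-sahi-p1`, generation 57; `--supports stmt-CriticalPhenomena-4575`); companion of
`…SahiThreeCopyPolarization` (the polarized three-copy functional `6T_b(t₁;t₂;t₃)` = `tcp6`, the `@[conjecture]` `PolarizedChainLaw`:
`6T_b(t₁;t₂;t₃) ≥ 0` for chains `t₁ ≤ t₂ ≤ t₃` of nonnegative monotone triples).  Pure proofs; no `sorry`, standard axioms; nothing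
conjectural is used.

* ★ `tcp6_zero_bottom_ge` / `tcp6_zero_bottom_nonneg`: **the chain law with bottom level `t₁ = 0` is a theorem** — for a two-level
  chain `t₂ ≤ t₃` of nonnegative monotone triples and every profile `b`,
  `6T_b(0;t₂;t₃) = 4N(P₂;1;1) + 4N(P₃;1;1) − Σ_s [N(s₂;(P/s)₃;1) + N(s₃;(P/s)₂;1)] ≥ N(P₂;1;1) + N(P₃;1;1) ≥ 0` (`P_k = f_kg_kh_k`,
  `s` ranging over the three slots): per slot, merge by three-copy Harris (`N(f₂;g₃h₃;1) ≤ N(f₂g₃h₃;1;1)`) and then use the cross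
  inequality `N(f₂g₃h₃) + N(f₃g₂h₂) ≤ N(f₂g₂h₂) + N(f₃g₃h₃)` (`N3_cross_le`).  These are the configurations "first copy switched off"
  (an AND-literal in every slot of the first copy); together with `tcp6_dim_zero_chain_nonneg` (dimension 0) and the two-level chains
  (`tc_cons_one/two_pol`: 3C-SAHI one dimension up) they are the settled instances of the chain law.  [this work]
* §2: `glue` (a function on the (d+1)-cube from two prescribed sections), `sliceLaw_sections` ((SC) for section data on the d-cube:
  `2·6T(t¹;t¹;t¹) ≤ 3·6T(t⁰;t¹;t¹)`), ★ `tcp6_twoSlot` (identity: for chains with a CONSTANT third slot,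
  `6·6T(t₁;t₂;t₃) = Σ_{(k,l)=(1,2),(2,3),(1,3)}[3·6T(t_k;t_l;t_l) − 2·6T(t_l;t_l;t_l)] + 6T(t₂;t₂;t₂) + 2·6T(t₃;t₃;t₃)`, i.e.
  `6T = 2Σ_k c(t_k) + 2Y₂₂ + Y₂₃ + Y₃₂ + 2Y₃₃` in slot increments) and ★ `tcp6_twoSlot_nonneg_of_sliceLaw`: **(SC) ⇒ the chain law for
  chains moving in at most two slots** (three pair steps + 3C).  [this work]
* §3 ★★ `tcp6_chain_identity` (all real data): `6·6T(t₁;t₂;t₃) = Σ_{(k,l)}[3·6T(t_k;t_l;t_l) − 2·6T(t_l;t_l;t_l)] + 6T(t₂;t₂;t₂) +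
  2·6T(t₃;t₃;t₃) + 6[N(δ_f;ε_g;ε_h) + N(ε_f;δ_g;ε_h) + N(ε_f;ε_g;δ_h)] + 12N(ε_f;ε_g;ε_h)` (δ = t₂ − t₁, ε = t₃ − t₂): beyond the three
  pair steps and `c(t₂) + 2c(t₃)`, the chain functional is a POSITIVE combination of three-copy functionals of the nonnegative
  increments.  Hence ★★ `polarizedChainLaw_of_sliceLaw`: **(SC) ⇒ the chain law** (so `PolarizedChainLaw` lies between (SC) and
  3C-SAHI), and `tc_cons_one_two_symm_ge_of_sliceLaw`: (SC) ⇒ `c_{(1,2,b)} ≥ 3c_b(t^{01})` for `(x₀,x₁)`-symmetric triples.  [this work]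
* §4 `tcp6_third_diff_ddd/dde/dee` (all real data) + `_nonneg`: the MIXED THIRD DIFFERENCES of `6T` along a chain (each copy differenced
  once, steps δ = t₂−t₁ or ε = t₃−t₂) kill every term except the permutation part and equal `6N(δ_f;δ_g;δ_h)`,
  `2[N(δ_f;δ_g;ε_h)+N(δ_f;ε_g;δ_h)+N(ε_f;δ_g;δ_h)]`, `2[N(δ_f;ε_g;ε_h)+N(ε_f;δ_g;ε_h)+N(ε_f;ε_g;δ_h)]` — nonnegative for chains.  With
  3C at each level and (SC) for each pair of levels these were first guessed to be the complete facet list of the cone of chain vectors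
  (they are linearly independent and C(m+2,3) = dim in number); that guess is FALSE: (SC) applied to INTERLEAVED GLUINGS of a chain gives
  further valid chain inequalities with a negative coefficient in this basis (`…SahiThreeCopyPolarizationGrid`: `sliceLaw_chain_glued_122/222/133`,
  memo FROM-prim-sahi-p1-gen57 §3).  [this work]
-/

namespace Summit.CriticalPhenomena.PercolationContinuityZ3.Theorems.SahiThreeCopy

open Finset Function Literature.Combinatorics.Sahi2008
open scoped BigOperators

noncomputable section

variable {d : ℕ}

/-- `N_b(f;0;h) = 0` (local copy). [this work] -/
private theorem N3_zero_mid_polc (b : Fin d → ℕ) (f h : Pt d → ℝ) : N3 b f 0 h = 0 := by rw [N3_comm12, N3_zero_left]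

/-- `N_b(f;g;0) = 0` (local copy). [this work] -/
private theorem N3_zero_right_polc (b : Fin d → ℕ) (f g : Pt d → ℝ) : N3 b f g 0 = 0 := by rw [N3_comm13, N3_zero_left]

/-! ### §1 The chain law with bottom level `0` is three-copy Harris -/

/-- ★ **The chain law at `t₁ = 0`.**  For a two-level chain `t₂ ≤ t₃` of nonnegative monotone triples,
`6T_b(0;t₂;t₃) = 4N(P₂;1;1) + 4N(P₃;1;1) − Σ_s [N(s₂;(P/s)₃;1) + N(s₃;(P/s)₂;1)] ≥ N(P₂;1;1) + N(P₃;1;1)` (`P_k = f_kg_kh_k`):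
for each slot, merge (`N(f₂;g₃h₃;1) ≤ N(f₂g₃h₃;1;1)`, three-copy Harris) and then apply the cross inequality
`N(f₂g₃h₃) + N(f₃g₂h₂) ≤ N(f₂g₂h₂) + N(f₃g₃h₃)` (`N3_cross_le`).  So the configurations `(0;t₂;t₃)` — the first copy switched off,
as for an AND-literal in every slot — satisfy the chain law with room `N(P₂)+N(P₃)` to spare. [this work] -/
theorem tcp6_zero_bottom_ge (b : Fin d → ℕ) {f₂ g₂ h₂ f₃ g₃ h₃ : Pt d → ℝ}
    (hf₂ : ∀ x, 0 ≤ f₂ x) (hg₂ : ∀ x, 0 ≤ g₂ x) (hh₂ : ∀ x, 0 ≤ h₂ x)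
    (hf₂m : Monotone f₂) (hg₂m : Monotone g₂) (hh₂m : Monotone h₂) (hf₃m : Monotone f₃) (hg₃m : Monotone g₃) (hh₃m : Monotone h₃)
    (hf : ∀ x, f₂ x ≤ f₃ x) (hg : ∀ x, g₂ x ≤ g₃ x) (hh : ∀ x, h₂ x ≤ h₃ x) :
    N3 b (f₂ * g₂ * h₂) 1 1 + N3 b (f₃ * g₃ * h₃) 1 1 ≤ tcp6 b 0 0 0 f₂ g₂ h₂ f₃ g₃ h₃ := by
  have hf₃ : ∀ x, 0 ≤ f₃ x := fun x => (hf₂ x).trans (hf x)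
  have hg₃ : ∀ x, 0 ≤ g₃ x := fun x => (hg₂ x).trans (hg x)
  have hh₃ : ∀ x, 0 ≤ h₃ x := fun x => (hh₂ x).trans (hh x)
  have one_nn : ∀ x : Pt d, (0 : ℝ) ≤ (1 : Pt d → ℝ) x := fun _ => zero_le_one
  -- monotone nonnegative products
  have pm : ∀ {u v : Pt d → ℝ}, (∀ x, 0 ≤ u x) → (∀ x, 0 ≤ v x) → Monotone u → Monotone v → Monotone (u * v) :=
    fun hu hv hum hvm x y hxy => mul_le_mul (hum hxy) (hvm hxy) (hv x) (hu y)
  have pn : ∀ {u v : Pt d → ℝ}, (∀ x, 0 ≤ u x) → (∀ x, 0 ≤ v x) → ∀ x, 0 ≤ (u * v) x := fun hu hv x => mul_nonneg (hu x) (hv x)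
  have pl : ∀ {u₀ u₁ v₀ v₁ : Pt d → ℝ}, (∀ x, 0 ≤ u₀ x) → (∀ x, 0 ≤ v₀ x) → (∀ x, u₀ x ≤ u₁ x) → (∀ x, v₀ x ≤ v₁ x) →
      ∀ x, (u₀ * v₀) x ≤ (u₁ * v₁) x :=
    fun hu hv huu hvv x => mul_le_mul (huu x) (hvv x) (hv x) ((hu x).trans (huu x))
  -- merge step (three-copy Harris), written with the single function in the FIRST slot and the product in the second
  have merge : ∀ {u v : Pt d → ℝ}, (∀ x, 0 ≤ u x) → Monotone u → (∀ x, 0 ≤ v x) → Monotone v →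
      N3 b u v 1 ≤ N3 b (u * v) 1 1 := fun hu hum hv hvm => N3_le_N3_mul d b _ _ 1 hu hum hv hvm one_nn
  -- slot f
  have mf₂ := merge hf₂ hf₂m (pn hg₃ hh₃) (pm hg₃ hh₃ hg₃m hh₃m)      -- N(f₂;g₃h₃;1) ≤ N(f₂(g₃h₃);1;1)
  have mf₃ := merge hf₃ hf₃m (pn hg₂ hh₂) (pm hg₂ hh₂ hg₂m hh₂m)      -- N(f₃;g₂h₂;1) ≤ N(f₃(g₂h₂);1;1)
  have cf := N3_cross_le b (f₁ := f₃) (f₀ := f₂) (g₁ := g₃ * h₃) (g₀ := g₂ * h₂) (u := 1) (r := 1) hf (pl hg₂ hh₂ hg hh) one_nn one_nn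
  -- slot g (the single function g_i, product f_j h_j)
  have mg₂ := merge hg₂ hg₂m (pn hf₃ hh₃) (pm hf₃ hh₃ hf₃m hh₃m)
  have mg₃ := merge hg₃ hg₃m (pn hf₂ hh₂) (pm hf₂ hh₂ hf₂m hh₂m)
  have cg := N3_cross_le b (f₁ := g₃) (f₀ := g₂) (g₁ := f₃ * h₃) (g₀ := f₂ * h₂) (u := 1) (r := 1) hg (pl hf₂ hh₂ hf hh) one_nn one_nn
  -- slot h
  have mh₂ := merge hh₂ hh₂m (pn hf₃ hg₃) (pm hf₃ hg₃ hf₃m hg₃m)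
  have mh₃ := merge hh₃ hh₃m (pn hf₂ hg₂) (pm hf₂ hg₂ hf₂m hg₂m)
  have ch := N3_cross_le b (f₁ := h₃) (f₀ := h₂) (g₁ := f₃ * g₃) (g₀ := f₂ * g₂) (u := 1) (r := 1) hh (pl hf₂ hg₂ hf hg) one_nn one_nn
  -- the diagonal products are all the same function `f_k g_k h_k`
  have e1 : g₃ * (f₃ * h₃) = f₃ * g₃ * h₃ := by ring
  have e2 : g₂ * (f₂ * h₂) = f₂ * g₂ * h₂ := by ring
  have e3 : h₃ * (f₃ * g₃) = f₃ * g₃ * h₃ := by ring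
  have e4 : h₂ * (f₂ * g₂) = f₂ * g₂ * h₂ := by ring
  have e5 : f₃ * (g₃ * h₃) = f₃ * g₃ * h₃ := by ring
  have e6 : f₂ * (g₂ * h₂) = f₂ * g₂ * h₂ := by ring
  rw [e1, e2] at cg; rw [e3, e4] at ch; rw [e5, e6] at cf
  unfold tcp6
  simp only [mul_zero, N3_zero_left, N3_zero_mid_polc, N3_zero_right_polc]
  linarith [mf₂, mf₃, cf, mg₂, mg₃, cg, mh₂, mh₃, ch]

/-- Hence **the chain law holds whenever the bottom level is `0`**: `0 ≤ 6T_b(0;t₂;t₃)` for `t₂ ≤ t₃` nonnegative monotone — the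
instances of `PolarizedChainLaw` with `f₁ = g₁ = h₁ = 0` are theorems (three-copy Harris only). [this work] -/
theorem tcp6_zero_bottom_nonneg (b : Fin d → ℕ) {f₂ g₂ h₂ f₃ g₃ h₃ : Pt d → ℝ}
    (hf₂ : ∀ x, 0 ≤ f₂ x) (hg₂ : ∀ x, 0 ≤ g₂ x) (hh₂ : ∀ x, 0 ≤ h₂ x)
    (hf₂m : Monotone f₂) (hg₂m : Monotone g₂) (hh₂m : Monotone h₂) (hf₃m : Monotone f₃) (hg₃m : Monotone g₃) (hh₃m : Monotone h₃)
    (hf : ∀ x, f₂ x ≤ f₃ x) (hg : ∀ x, g₂ x ≤ g₃ x) (hh : ∀ x, h₂ x ≤ h₃ x) :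
    0 ≤ tcp6 b 0 0 0 f₂ g₂ h₂ f₃ g₃ h₃ := by
  have h := tcp6_zero_bottom_ge b hf₂ hg₂ hh₂ hf₂m hg₂m hh₂m hf₃m hg₃m hh₃m hf hg hh
  have hf₃ : ∀ x, 0 ≤ f₃ x := fun x => (hf₂ x).trans (hf x)
  have hg₃ : ∀ x, 0 ≤ g₃ x := fun x => (hg₂ x).trans (hg x)
  have hh₃ : ∀ x, 0 ≤ h₃ x := fun x => (hh₂ x).trans (hh x)
  have p2 : 0 ≤ N3 b (f₂ * g₂ * h₂) 1 1 :=
    N3_nonneg b (fun x => mul_nonneg (mul_nonneg (hf₂ x) (hg₂ x)) (hh₂ x)) (fun _ => zero_le_one) fun _ => zero_le_one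
  have p3 : 0 ≤ N3 b (f₃ * g₃ * h₃) 1 1 :=
    N3_nonneg b (fun x => mul_nonneg (mul_nonneg (hf₃ x) (hg₃ x)) (hh₃ x)) (fun _ => zero_le_one) fun _ => zero_le_one
  linarith

/-! ### §2 Gluing sections; (SC) in section-data form; the chain law on TWO-SLOT chains follows from (SC) -/

/-- Glue two functions on the `d`-cube into one on the `(d+1)`-cube with prescribed sections along coordinate `0`:
`glue lo hi (ε, x) = if ε then hi x else lo x`. [this work] -/
def glue (lo hi : Pt d → ℝ) : Pt (d + 1) → ℝ := fun x => if x 0 = true then hi (Fin.tail x) else lo (Fin.tail x)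

/-- The bottom section of `glue lo hi` is `lo`. [this work] -/
theorem sec_glue_false (lo hi : Pt d → ℝ) : sec (glue lo hi) false = lo := by
  funext x; simp [sec, glue]

/-- The top section of `glue lo hi` is `hi`. [this work] -/
theorem sec_glue_true (lo hi : Pt d → ℝ) : sec (glue lo hi) true = hi := by
  funext x; simp [sec, glue]

/-- `glue lo hi ≥ 0` if both pieces are. [this work] -/
theorem glue_nonneg {lo hi : Pt d → ℝ} (hlo : ∀ x, 0 ≤ lo x) (hhi : ∀ x, 0 ≤ hi x) : ∀ x, 0 ≤ glue lo hi x := by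
  intro x; unfold glue; split_ifs
  · exact hhi _
  · exact hlo _

/-- `glue lo hi` is monotone if both pieces are monotone and `lo ≤ hi`. [this work] -/
theorem glue_monotone {lo hi : Pt d → ℝ} (hlom : Monotone lo) (hhim : Monotone hi) (hle : ∀ x, lo x ≤ hi x) :
    Monotone (glue lo hi) := by
  intro x y hxy
  have h0 : x 0 ≤ y 0 := hxy 0
  have ht : Fin.tail x ≤ Fin.tail y := fun i => hxy i.succ
  unfold glue
  by_cases hx : x 0 = true
  · have hy : y 0 = true := by
      cases h : y 0
      · rw [hx, h] at h0; exact absurd h0 (by decide)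
      · rfl
    rw [if_pos hx, if_pos hy]; exact hhim ht
  · rw [if_neg hx]
    by_cases hy : y 0 = true
    · rw [if_pos hy]; exact (hlom ht).trans (hle _)
    · rw [if_neg hy]; exact hlom ht

/-- ★ **(SC) in section-data form.**  The slice law, stated for data on the `d`-cube: for nonnegative monotone triples `t⁰ ≤ t¹`,
`2·6T_b(t¹;t¹;t¹) ≤ 3·6T_b(t⁰;t¹;t¹)` (glue the sections and apply `sliceLaw_iff_pol`). [this work] -/
theorem sliceLaw_sections (hSC : SliceLaw) (b : Fin d → ℕ) {f₀ g₀ h₀ f₁ g₁ h₁ : Pt d → ℝ}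
    (hf₀ : ∀ x, 0 ≤ f₀ x) (hg₀ : ∀ x, 0 ≤ g₀ x) (hh₀ : ∀ x, 0 ≤ h₀ x)
    (hf₀m : Monotone f₀) (hg₀m : Monotone g₀) (hh₀m : Monotone h₀) (hf₁m : Monotone f₁) (hg₁m : Monotone g₁) (hh₁m : Monotone h₁)
    (hf : ∀ x, f₀ x ≤ f₁ x) (hg : ∀ x, g₀ x ≤ g₁ x) (hh : ∀ x, h₀ x ≤ h₁ x) :
    2 * tcp6 b f₁ g₁ h₁ f₁ g₁ h₁ f₁ g₁ h₁ ≤ 3 * tcp6 b f₀ g₀ h₀ f₁ g₁ h₁ f₁ g₁ h₁ := by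
  have hf₁ : ∀ x, 0 ≤ f₁ x := fun x => (hf₀ x).trans (hf x)
  have hg₁ : ∀ x, 0 ≤ g₁ x := fun x => (hg₀ x).trans (hg x)
  have hh₁ : ∀ x, 0 ≤ h₁ x := fun x => (hh₀ x).trans (hh x)
  have key := (sliceLaw_iff_pol.1 hSC) d b (glue f₀ f₁) (glue g₀ g₁) (glue h₀ h₁) (glue_nonneg hf₀ hf₁) (glue_nonneg hg₀ hg₁)
    (glue_nonneg hh₀ hh₁) (glue_monotone hf₀m hf₁m hf) (glue_monotone hg₀m hg₁m hg) (glue_monotone hh₀m hh₁m hh)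
  simpa only [sec_glue_false, sec_glue_true] using key

/-- ★ **The two-slot chain identity** (all real data): for a chain moving in the slots `f` and `g` only (common `h`),
`6·6T(t₁;t₂;t₃) = Σ_{(k,l) ∈ {(1,2),(2,3),(1,3)}} [3·6T(t_k;t_l;t_l) − 2·6T(t_l;t_l;t_l)] + 6T(t₂;t₂;t₂) + 2·6T(t₃;t₃;t₃)`,
i.e. `6T = 2Σ_k c(t_k) + 2Y(h;φ₂,γ₂) + Y(h;φ₂,γ₃) + Y(h;φ₃,γ₂) + 2Y(h;φ₃,γ₃)` with the slot increments `φ, γ` and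
`Y(h;u,v) = N(u;hv;1) + N(v;hu;1) − N(h;u;v)`: the three brackets are the pair steps `c(t_k) + Y(h;f_l − f_k, g_l − g_k)` of the slice
law with the third slot not depending on the sliced coordinate. [this work] -/
theorem tcp6_twoSlot (b : Fin d → ℕ) (f₁ f₂ f₃ g₁ g₂ g₃ h : Pt d → ℝ) :
    6 * tcp6 b f₁ g₁ h f₂ g₂ h f₃ g₃ h =
      (3 * tcp6 b f₁ g₁ h f₂ g₂ h f₂ g₂ h - 2 * tcp6 b f₂ g₂ h f₂ g₂ h f₂ g₂ h)
      + (3 * tcp6 b f₂ g₂ h f₃ g₃ h f₃ g₃ h - 2 * tcp6 b f₃ g₃ h f₃ g₃ h f₃ g₃ h)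
      + (3 * tcp6 b f₁ g₁ h f₃ g₃ h f₃ g₃ h - 2 * tcp6 b f₃ g₃ h f₃ g₃ h f₃ g₃ h)
      + tcp6 b f₂ g₂ h f₂ g₂ h f₂ g₂ h + 2 * tcp6 b f₃ g₃ h f₃ g₃ h f₃ g₃ h := by
  unfold tcp6; ring

/-- ★ **(SC) ⇒ the chain law on two-slot chains.**  If the slice law holds, then for every chain `t₁ ≤ t₂ ≤ t₃` of nonnegative
monotone triples in which the third slot is constant (`h₁ = h₂ = h₃ = h`), `0 ≤ 6T_b(t₁;t₂;t₃)` — by `tcp6_twoSlot`, three pair-step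
instances of (SC) and `c(t₂), c(t₃) ≥ 0` ((SC) ⇒ 3C-SAHI).  So the genuinely new content of `PolarizedChainLaw` relative to (SC) lies in
chains moving in all three slots (kit j335595: there it is NOT a linear consequence of (SC)). [this work] -/
theorem tcp6_twoSlot_nonneg_of_sliceLaw (hSC : SliceLaw) (b : Fin d → ℕ) {f₁ f₂ f₃ g₁ g₂ g₃ h : Pt d → ℝ}
    (hf₁ : ∀ x, 0 ≤ f₁ x) (hg₁ : ∀ x, 0 ≤ g₁ x) (hh : ∀ x, 0 ≤ h x)
    (hf₁m : Monotone f₁) (hf₂m : Monotone f₂) (hf₃m : Monotone f₃) (hg₁m : Monotone g₁) (hg₂m : Monotone g₂) (hg₃m : Monotone g₃)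
    (hhm : Monotone h) (hf₁₂ : ∀ x, f₁ x ≤ f₂ x) (hf₂₃ : ∀ x, f₂ x ≤ f₃ x) (hg₁₂ : ∀ x, g₁ x ≤ g₂ x) (hg₂₃ : ∀ x, g₂ x ≤ g₃ x) :
    0 ≤ tcp6 b f₁ g₁ h f₂ g₂ h f₃ g₃ h := by
  have hf₂ : ∀ x, 0 ≤ f₂ x := fun x => (hf₁ x).trans (hf₁₂ x)
  have hg₂ : ∀ x, 0 ≤ g₂ x := fun x => (hg₁ x).trans (hg₁₂ x)
  have hf₃ : ∀ x, 0 ≤ f₃ x := fun x => (hf₂ x).trans (hf₂₃ x)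
  have hg₃ : ∀ x, 0 ≤ g₃ x := fun x => (hg₂ x).trans (hg₂₃ x)
  have hle : ∀ x, h x ≤ h x := fun _ => le_rfl
  have s12 := sliceLaw_sections hSC b hf₁ hg₁ hh hf₁m hg₁m hhm hf₂m hg₂m hhm hf₁₂ hg₁₂ hle
  have s23 := sliceLaw_sections hSC b hf₂ hg₂ hh hf₂m hg₂m hhm hf₃m hg₃m hhm hf₂₃ hg₂₃ hle
  have s13 := sliceLaw_sections hSC b hf₁ hg₁ hh hf₁m hg₁m hhm hf₃m hg₃m hhm (fun x => (hf₁₂ x).trans (hf₂₃ x))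
    (fun x => (hg₁₂ x).trans (hg₂₃ x)) hle
  have h3C := threeCopySahi_of_sliceLaw hSC
  have c2 : 0 ≤ tc b f₂ g₂ h := h3C d b f₂ g₂ h hf₂ hg₂ hh hf₂m hg₂m hhm
  have c3 : 0 ≤ tc b f₃ g₃ h := h3C d b f₃ g₃ h hf₃ hg₃ hh hf₃m hg₃m hhm
  have e2 := tcp6_diag b f₂ g₂ h
  have e3 := tcp6_diag b f₃ g₃ h
  have key := tcp6_twoSlot b f₁ f₂ f₃ g₁ g₂ g₃ h
  nlinarith [s12, s23, s13, c2, c3, e2, e3, key]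

/-! ### §3 ★★ The slice law implies the chain law: the three-slot chain identity -/

/-- ★★ **The chain identity.**  For ANY nine real functions (three triples `t_k = (f_k,g_k,h_k)`), with the level increments
`δ = t₂ − t₁`, `ε = t₃ − t₂` (slotwise):
`6·6T(t₁;t₂;t₃) = Σ_{(k,l)=(1,2),(2,3),(1,3)} [3·6T(t_k;t_l;t_l) − 2·6T(t_l;t_l;t_l)] + 6T(t₂;t₂;t₂) + 2·6T(t₃;t₃;t₃)
   + 6·[N(δ_f;ε_g;ε_h) + N(ε_f;δ_g;ε_h) + N(ε_f;ε_g;δ_h)] + 12·N(ε_f;ε_g;ε_h)`.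
The three brackets are `6·(c₂ − 2c₃)` of the `(d+1)`-dimensional triples glued from the level pairs `(t_k,t_l)` (nonnegative under the
slice law (SC)), the next two are `6c(t₂) + 12c(t₃)`, and the remainder is a sum of three-copy functionals of NONNEGATIVE increments. [this work] -/
theorem tcp6_chain_identity (b : Fin d → ℕ) (f₁ g₁ h₁ f₂ g₂ h₂ f₃ g₃ h₃ : Pt d → ℝ) :
    6 * tcp6 b f₁ g₁ h₁ f₂ g₂ h₂ f₃ g₃ h₃ =
      (3 * tcp6 b f₁ g₁ h₁ f₂ g₂ h₂ f₂ g₂ h₂ - 2 * tcp6 b f₂ g₂ h₂ f₂ g₂ h₂ f₂ g₂ h₂)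
      + (3 * tcp6 b f₂ g₂ h₂ f₃ g₃ h₃ f₃ g₃ h₃ - 2 * tcp6 b f₃ g₃ h₃ f₃ g₃ h₃ f₃ g₃ h₃)
      + (3 * tcp6 b f₁ g₁ h₁ f₃ g₃ h₃ f₃ g₃ h₃ - 2 * tcp6 b f₃ g₃ h₃ f₃ g₃ h₃ f₃ g₃ h₃)
      + tcp6 b f₂ g₂ h₂ f₂ g₂ h₂ f₂ g₂ h₂ + 2 * tcp6 b f₃ g₃ h₃ f₃ g₃ h₃ f₃ g₃ h₃
      + 6 * (N3 b (f₂ - f₁) (g₃ - g₂) (h₃ - h₂) + N3 b (f₃ - f₂) (g₂ - g₁) (h₃ - h₂) + N3 b (f₃ - f₂) (g₃ - g₂) (h₂ - h₁))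
      + 12 * N3 b (f₃ - f₂) (g₃ - g₂) (h₃ - h₂) := by
  unfold tcp6
  simp only [N3_sub_left, N3_sub_mid, N3_sub_right]
  ring


/-- ★★ **(SC) ⇒ (CHAIN).**  The slice law implies the polarized chain law: for every chain `t₁ ≤ t₂ ≤ t₃` of nonnegative monotone
triples and every profile, `0 ≤ 6T_b(t₁;t₂;t₃)` — by `tcp6_chain_identity`: three pair steps of (SC) (`sliceLaw_sections` for the
level pairs (1,2), (2,3), (1,3)), `c(t₂), c(t₃) ≥ 0` ((SC) ⇒ 3C-SAHI, `threeCopySahi_of_sliceLaw`), and three-copy functionals of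
the nonnegative increments.  So `PolarizedChainLaw` sits between (SC) and 3C-SAHI (`threeCopySahi_of_chainLaw`); it is NOT a
linear consequence of 3C one dimension up (kit j335595, target A). [this work] -/
theorem polarizedChainLaw_of_sliceLaw (hSC : SliceLaw) : PolarizedChainLaw := by
  intro d b f₁ g₁ h₁ f₂ g₂ h₂ f₃ g₃ h₃ hf₁ hg₁ hh₁ hf₁m hg₁m hh₁m hf₂m hg₂m hh₂m hf₃m hg₃m hh₃m hf₁₂ hg₁₂ hh₁₂ hf₂₃ hg₂₃ hh₂₃
  have hf₂ : ∀ x, 0 ≤ f₂ x := fun x => (hf₁ x).trans (hf₁₂ x)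
  have hg₂ : ∀ x, 0 ≤ g₂ x := fun x => (hg₁ x).trans (hg₁₂ x)
  have hh₂ : ∀ x, 0 ≤ h₂ x := fun x => (hh₁ x).trans (hh₁₂ x)
  have hf₃ : ∀ x, 0 ≤ f₃ x := fun x => (hf₂ x).trans (hf₂₃ x)
  have hg₃ : ∀ x, 0 ≤ g₃ x := fun x => (hg₂ x).trans (hg₂₃ x)
  have hh₃ : ∀ x, 0 ≤ h₃ x := fun x => (hh₂ x).trans (hh₂₃ x)
  have s12 := sliceLaw_sections hSC b hf₁ hg₁ hh₁ hf₁m hg₁m hh₁m hf₂m hg₂m hh₂m hf₁₂ hg₁₂ hh₁₂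
  have s23 := sliceLaw_sections hSC b hf₂ hg₂ hh₂ hf₂m hg₂m hh₂m hf₃m hg₃m hh₃m hf₂₃ hg₂₃ hh₂₃
  have s13 := sliceLaw_sections hSC b hf₁ hg₁ hh₁ hf₁m hg₁m hh₁m hf₃m hg₃m hh₃m (fun x => (hf₁₂ x).trans (hf₂₃ x))
    (fun x => (hg₁₂ x).trans (hg₂₃ x)) (fun x => (hh₁₂ x).trans (hh₂₃ x))
  have h3C := threeCopySahi_of_sliceLaw hSC
  have c2 : 0 ≤ tc b f₂ g₂ h₂ := h3C d b f₂ g₂ h₂ hf₂ hg₂ hh₂ hf₂m hg₂m hh₂m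
  have c3 : 0 ≤ tc b f₃ g₃ h₃ := h3C d b f₃ g₃ h₃ hf₃ hg₃ hh₃ hf₃m hg₃m hh₃m
  have e2 := tcp6_diag b f₂ g₂ h₂
  have e3 := tcp6_diag b f₃ g₃ h₃
  have d12 : ∀ x, 0 ≤ (f₂ - f₁) x := fun x => sub_nonneg.2 (hf₁₂ x)
  have d23 : ∀ x, 0 ≤ (f₃ - f₂) x := fun x => sub_nonneg.2 (hf₂₃ x)
  have e12 : ∀ x, 0 ≤ (g₂ - g₁) x := fun x => sub_nonneg.2 (hg₁₂ x)
  have e23 : ∀ x, 0 ≤ (g₃ - g₂) x := fun x => sub_nonneg.2 (hg₂₃ x)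
  have k12 : ∀ x, 0 ≤ (h₂ - h₁) x := fun x => sub_nonneg.2 (hh₁₂ x)
  have k23 : ∀ x, 0 ≤ (h₃ - h₂) x := fun x => sub_nonneg.2 (hh₂₃ x)
  have p1 : 0 ≤ N3 b (f₂ - f₁) (g₃ - g₂) (h₃ - h₂) := N3_nonneg b d12 e23 k23
  have p2 : 0 ≤ N3 b (f₃ - f₂) (g₂ - g₁) (h₃ - h₂) := N3_nonneg b d23 e12 k23
  have p3 : 0 ≤ N3 b (f₃ - f₂) (g₃ - g₂) (h₂ - h₁) := N3_nonneg b d23 e23 k12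
  have p4 : 0 ≤ N3 b (f₃ - f₂) (g₃ - g₂) (h₃ - h₂) := N3_nonneg b d23 e23 k23
  have key := tcp6_chain_identity b f₁ g₁ h₁ f₂ g₂ h₂ f₃ g₃ h₃
  nlinarith [s12, s23, s13, c2, c3, e2, e3, key, p1, p2, p3, p4]

/-- Hence (SC) ⇒ the second-order slice law for symmetric data: for an `(x₀,x₁)`-symmetric nonnegative monotone triple on `d+2`
coordinates, `3c_b(F^{01},G^{01},H^{01}) ≤ c_{(1,2,b)}(F,G,H)` (`tc_cons_one_two_symm` + the chain law for the section chain
`t^{00} ≤ t^{01} ≤ t^{11}`). [this work] -/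
theorem tc_cons_one_two_symm_ge_of_sliceLaw (hSC : SliceLaw) (b : Fin d → ℕ) {F G H : Pt (d + 2) → ℝ}
    (hF : ∀ x, 0 ≤ F x) (hG : ∀ x, 0 ≤ G x) (hH : ∀ x, 0 ≤ H x) (hFm : Monotone F) (hGm : Monotone G) (hHm : Monotone H)
    (hFs : sec2 F false true = sec2 F true false) (hGs : sec2 G false true = sec2 G true false)
    (hHs : sec2 H false true = sec2 H true false) :
    3 * tc b (sec2 F false true) (sec2 G false true) (sec2 H false true) ≤ tc (Fin.cons 1 (Fin.cons 2 b) : Fin (d + 2) → ℕ) F G H := by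
  rw [tc_cons_one_two_symm b F G H hFs hGs hHs]
  have hCL := polarizedChainLaw_of_sliceLaw hSC
  -- the section chain t^{00} ≤ t^{01} ≤ t^{11}
  have n00 : ∀ u : Pt (d + 2) → ℝ, (∀ x, 0 ≤ u x) → ∀ x, 0 ≤ sec2 u false false x := fun u hu x => hu _
  have mono : ∀ u : Pt (d + 2) → ℝ, Monotone u → ∀ a c, Monotone (sec2 u a c) :=
    fun u hu a c => sec_monotone (sec_monotone hu a) c
  have le1 : ∀ u : Pt (d + 2) → ℝ, Monotone u → ∀ x, sec2 u false false x ≤ sec2 u false true x :=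
    fun u hu x => sec_false_le_sec_true (sec_monotone hu false) x
  have le2 : ∀ u : Pt (d + 2) → ℝ, Monotone u → sec2 u false true = sec2 u true false → ∀ x, sec2 u false true x ≤ sec2 u true true x := by
    intro u hu hs x; rw [hs]; exact sec_false_le_sec_true (sec_monotone hu true) x
  have h := hCL d b (sec2 F false false) (sec2 G false false) (sec2 H false false) (sec2 F false true) (sec2 G false true)
    (sec2 H false true) (sec2 F true true) (sec2 G true true) (sec2 H true true) (n00 F hF) (n00 G hG) (n00 H hH)
    (mono F hFm _ _) (mono G hGm _ _) (mono H hHm _ _) (mono F hFm _ _) (mono G hGm _ _) (mono H hHm _ _)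
    (mono F hFm _ _) (mono G hGm _ _) (mono H hHm _ _) (le1 F hFm) (le1 G hGm) (le1 H hHm) (le2 F hFm hFs) (le2 G hGm hGs)
    (le2 H hHm hHs)
  linarith

/-! ### §4 Mixed third differences of the polarized functional are three-copy functionals of the increments -/

/-- ★ **Mixed third differences, pattern (δ,δ,δ)** (all real data): differencing each copy once between the levels `t₁ → t₂` kills every
term of `6T` except the permutation terms, which are trilinear in the copies:
`−6T(t₁;t₁;t₁) + 3·6T(t₁;t₁;t₂) − 3·6T(t₁;t₂;t₂) + 6T(t₂;t₂;t₂) = 6·N(δ_f;δ_g;δ_h)`, `δ = t₂ − t₁` (the alternating identity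
`c₁ − c₂ + c₃ − c₀ = N(δF;δG;δH)` of `…SliceLaw` in polarized form). [this work] -/
theorem tcp6_third_diff_ddd (b : Fin d → ℕ) (f₁ g₁ h₁ f₂ g₂ h₂ : Pt d → ℝ) :
    - tcp6 b f₁ g₁ h₁ f₁ g₁ h₁ f₁ g₁ h₁ + 3 * tcp6 b f₁ g₁ h₁ f₁ g₁ h₁ f₂ g₂ h₂ - 3 * tcp6 b f₁ g₁ h₁ f₂ g₂ h₂ f₂ g₂ h₂
      + tcp6 b f₂ g₂ h₂ f₂ g₂ h₂ f₂ g₂ h₂ = 6 * N3 b (f₂ - f₁) (g₂ - g₁) (h₂ - h₁) := by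
  unfold tcp6
  simp only [N3_sub_left, N3_sub_mid, N3_sub_right]
  ring

/-- ★ **Mixed third differences, pattern (δ,δ,ε)** for three levels (all real data), `δ = t₂ − t₁`, `ε = t₃ − t₂`:
`−6T(t₁;t₁;t₂) + 6T(t₁;t₁;t₃) + 2·6T(t₁;t₂;t₂) − 2·6T(t₁;t₂;t₃) − 6T(t₂;t₂;t₂) + 6T(t₂;t₂;t₃)
  = 2[N(δ_f;δ_g;ε_h) + N(δ_f;ε_g;δ_h) + N(ε_f;δ_g;δ_h)]` — nonnegative for chains. [this work] -/
theorem tcp6_third_diff_dde (b : Fin d → ℕ) (f₁ g₁ h₁ f₂ g₂ h₂ f₃ g₃ h₃ : Pt d → ℝ) :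
    - tcp6 b f₁ g₁ h₁ f₁ g₁ h₁ f₂ g₂ h₂ + tcp6 b f₁ g₁ h₁ f₁ g₁ h₁ f₃ g₃ h₃ + 2 * tcp6 b f₁ g₁ h₁ f₂ g₂ h₂ f₂ g₂ h₂
      - 2 * tcp6 b f₁ g₁ h₁ f₂ g₂ h₂ f₃ g₃ h₃ - tcp6 b f₂ g₂ h₂ f₂ g₂ h₂ f₂ g₂ h₂ + tcp6 b f₂ g₂ h₂ f₂ g₂ h₂ f₃ g₃ h₃ =
      2 * (N3 b (f₂ - f₁) (g₂ - g₁) (h₃ - h₂) + N3 b (f₂ - f₁) (g₃ - g₂) (h₂ - h₁) + N3 b (f₃ - f₂) (g₂ - g₁) (h₂ - h₁)) := by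
  unfold tcp6
  simp only [N3_sub_left, N3_sub_mid, N3_sub_right]
  ring

/-- ★ **Mixed third differences, pattern (δ,ε,ε)** (all real data):
`−6T(t₁;t₂;t₂) + 2·6T(t₁;t₂;t₃) − 6T(t₁;t₃;t₃) + 6T(t₂;t₂;t₂) − 2·6T(t₂;t₂;t₃) + 6T(t₂;t₃;t₃)
  = 2[N(δ_f;ε_g;ε_h) + N(ε_f;δ_g;ε_h) + N(ε_f;ε_g;δ_h)]`. [this work] -/
theorem tcp6_third_diff_dee (b : Fin d → ℕ) (f₁ g₁ h₁ f₂ g₂ h₂ f₃ g₃ h₃ : Pt d → ℝ) :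
    - tcp6 b f₁ g₁ h₁ f₂ g₂ h₂ f₂ g₂ h₂ + 2 * tcp6 b f₁ g₁ h₁ f₂ g₂ h₂ f₃ g₃ h₃ - tcp6 b f₁ g₁ h₁ f₃ g₃ h₃ f₃ g₃ h₃
      + tcp6 b f₂ g₂ h₂ f₂ g₂ h₂ f₂ g₂ h₂ - 2 * tcp6 b f₂ g₂ h₂ f₂ g₂ h₂ f₃ g₃ h₃ + tcp6 b f₂ g₂ h₂ f₃ g₃ h₃ f₃ g₃ h₃ =
      2 * (N3 b (f₂ - f₁) (g₃ - g₂) (h₃ - h₂) + N3 b (f₃ - f₂) (g₂ - g₁) (h₃ - h₂) + N3 b (f₃ - f₂) (g₃ - g₂) (h₂ - h₁)) := by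
  unfold tcp6
  simp only [N3_sub_left, N3_sub_mid, N3_sub_right]
  ring

/-- Hence, for a chain `t₁ ≤ t₂ ≤ t₃` (only the order of the nine functions is used), the three mixed third differences are
nonnegative. [this work] -/
theorem tcp6_third_diff_dde_nonneg (b : Fin d → ℕ) {f₁ g₁ h₁ f₂ g₂ h₂ f₃ g₃ h₃ : Pt d → ℝ}
    (hf₁₂ : ∀ x, f₁ x ≤ f₂ x) (hg₁₂ : ∀ x, g₁ x ≤ g₂ x) (hh₁₂ : ∀ x, h₁ x ≤ h₂ x)
    (hf₂₃ : ∀ x, f₂ x ≤ f₃ x) (hg₂₃ : ∀ x, g₂ x ≤ g₃ x) (hh₂₃ : ∀ x, h₂ x ≤ h₃ x) :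
    0 ≤ - tcp6 b f₁ g₁ h₁ f₁ g₁ h₁ f₂ g₂ h₂ + tcp6 b f₁ g₁ h₁ f₁ g₁ h₁ f₃ g₃ h₃ + 2 * tcp6 b f₁ g₁ h₁ f₂ g₂ h₂ f₂ g₂ h₂
      - 2 * tcp6 b f₁ g₁ h₁ f₂ g₂ h₂ f₃ g₃ h₃ - tcp6 b f₂ g₂ h₂ f₂ g₂ h₂ f₂ g₂ h₂ + tcp6 b f₂ g₂ h₂ f₂ g₂ h₂ f₃ g₃ h₃ := by
  rw [tcp6_third_diff_dde]
  have a := fun x => sub_nonneg.2 (hf₁₂ x); have a' := fun x => sub_nonneg.2 (hf₂₃ x)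
  have c := fun x => sub_nonneg.2 (hg₁₂ x); have c' := fun x => sub_nonneg.2 (hg₂₃ x)
  have e := fun x => sub_nonneg.2 (hh₁₂ x); have e' := fun x => sub_nonneg.2 (hh₂₃ x)
  have p1 : 0 ≤ N3 b (f₂ - f₁) (g₂ - g₁) (h₃ - h₂) := N3_nonneg b a c e'
  have p2 : 0 ≤ N3 b (f₂ - f₁) (g₃ - g₂) (h₂ - h₁) := N3_nonneg b a c' e
  have p3 : 0 ≤ N3 b (f₃ - f₂) (g₂ - g₁) (h₂ - h₁) := N3_nonneg b a' c e
  linarith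

/-- The `(δ,ε,ε)` companion of `tcp6_third_diff_dde_nonneg`. [this work] -/
theorem tcp6_third_diff_dee_nonneg (b : Fin d → ℕ) {f₁ g₁ h₁ f₂ g₂ h₂ f₃ g₃ h₃ : Pt d → ℝ}
    (hf₁₂ : ∀ x, f₁ x ≤ f₂ x) (hg₁₂ : ∀ x, g₁ x ≤ g₂ x) (hh₁₂ : ∀ x, h₁ x ≤ h₂ x)
    (hf₂₃ : ∀ x, f₂ x ≤ f₃ x) (hg₂₃ : ∀ x, g₂ x ≤ g₃ x) (hh₂₃ : ∀ x, h₂ x ≤ h₃ x) :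
    0 ≤ - tcp6 b f₁ g₁ h₁ f₂ g₂ h₂ f₂ g₂ h₂ + 2 * tcp6 b f₁ g₁ h₁ f₂ g₂ h₂ f₃ g₃ h₃ - tcp6 b f₁ g₁ h₁ f₃ g₃ h₃ f₃ g₃ h₃
      + tcp6 b f₂ g₂ h₂ f₂ g₂ h₂ f₂ g₂ h₂ - 2 * tcp6 b f₂ g₂ h₂ f₂ g₂ h₂ f₃ g₃ h₃ + tcp6 b f₂ g₂ h₂ f₃ g₃ h₃ f₃ g₃ h₃ := by
  rw [tcp6_third_diff_dee]
  have a := fun x => sub_nonneg.2 (hf₁₂ x); have a' := fun x => sub_nonneg.2 (hf₂₃ x)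
  have c := fun x => sub_nonneg.2 (hg₁₂ x); have c' := fun x => sub_nonneg.2 (hg₂₃ x)
  have e := fun x => sub_nonneg.2 (hh₁₂ x); have e' := fun x => sub_nonneg.2 (hh₂₃ x)
  have p1 : 0 ≤ N3 b (f₂ - f₁) (g₃ - g₂) (h₃ - h₂) := N3_nonneg b a c' e'
  have p2 : 0 ≤ N3 b (f₃ - f₂) (g₂ - g₁) (h₃ - h₂) := N3_nonneg b a' c e'
  have p3 : 0 ≤ N3 b (f₃ - f₂) (g₃ - g₂) (h₂ - h₁) := N3_nonneg b a' c' e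
  linarith

end

end Summit.CriticalPhenomena.PercolationContinuityZ3.Theorems.SahiThreeCopy
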